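import Summits.QuantumFields.YangMills.Theorems.BalabanUVNodesN19JointLawClosedFormAtScheme

/-!
# YM-DAG node N19 (= NE7 proper) — THE WHOLE STRING-FIELD LAW IN CLOSED FORM: `(80K + 12G)·(1 + log(1+L)∕log 2)²∕(1 + L)`, `L = log R_K⁻¹`,
# in the product metric (module 62 §2's prose order `(log L)²∕L` as a theorem)

Cell `pub-ymgap`, HUMAN RULING D-0062 (Track A) ∕ D-0149 (work-bound push), R141 (C) wider-strategy seat `pub-ymgap-dag-n19-e` (strategy s3 =
ALTERNATIVE CURRENCY), generation g21, module 6 (lineage module 69).  Route `Summits/QuantumFields/YangMills/Theses/BalabanUVNodes.lean` rev 25,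
cluster item K3⁷ «SpineGivenEndpointR13SepCoPH» (stmt-QuantumFields-20544); filed `--supports` that item `--as helper` (it proves no registered
stub).  COUNT-NEUTRAL: bookkeeping over module 62 `…N19JointLawSharpRate` (`abs_integral_stringField_sub_le_of_uniformTarget_jackson`: the
`(M, m)`-parametrised rate `2K2^{−M} + 2πKM∕m + G(m9^m)^M R_K`), module 65 (`abs_integral_le_of_cube`), module 63 (`log_nine_le_five_halves`) and
module 67's `jointLaw_pushforward` pattern BY NAME; `Spine.NE7.Target` (N19's DECL-target SHAPE, NOT PRINTED, NOT proved) and the string-field law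
`Λ` are HYPOTHESES ∕ restatement devices; no Theses import; NOT a discharge claim.

THE RESULT.  ★★ `abs_integral_stringField_sub_le_closedForm_of_uniformTarget`: under uniform `Target` (`0 < l₀`, `[Countable O]`), for a
string-field law `Λ` on the cube receiving all continuous functionals, every enumeration `e : ℕ → List O`, every continuous `F` with
`|F x − F y| ≤ K_F Σ_j 2^{−(j+1)}|x_{e_j} − y_{e_j}|`, `|F| ≤ G_F` on the cube, and every step `K` with `R_K ∈ (0,1]`, `L := log R_K⁻¹`:
  `|∫ F((∏os)_{os}) dgibbs_K − ∫ F dΛ| ≤ (80·K_F + 12·G_F)·(1 + log(1+L)∕log 2)²∕(1 + L)`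
(module 62 §2 at the truncation level `M = ⌊log₂⌊1+L⌋⌋ + 1` — `2^{−M} ≤ 2∕(1+L)`, `M ≤ 1 + log(1+L)∕log 2` — and the Jackson parameter
`m = ⌊L∕(5M)⌋` when `L ≥ 5M` (`(m9^m)^M R_K ≤ e^{−3L∕10} ≤ (10∕3)∕(1+L)` exactly as module 65 with `|ι| ↦ M`, `2πKM∕m ≤ 76KM²∕(1+L)`), the trivial
`2G_F ≤ 12G_F M∕(1+L)` when `L < 5M`): order `(log L)²∕L`, for geometric remainders `(log K)²∕K`.  FROM BELOW the product-metric class cannot beat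
`c∕(1+L)` at the law level even through its FIRST coordinate (module 63 ∕ 66's binomial witness read on `x ↦ ½g(x_{e_0})`, weight `2^{−1}`): the
closed form is sharp up to the squared logarithm (not closed here).

HONEST FRAMING (binding).  Bookkeeping; `Λ` is a typed RESTATEMENT DEVICE (dag-lead guard); NO consumer in the DAG today; `Target` HYPOTHESIS; constants
not optimised; nothing of Bałaban's instantiated; NE7 NOT PRINTED, NOT proved; N19 NOT discharged; count-neutral.  One finite `T⁴` programme at fixed
`ε` → 0 at FIXED volume; NOT a continuum ∕ `ℝ⁴` ∕ infinite-volume ∕ OS ∕ mass-gap ∕ Clay statement.  0 `def` ∕ 0 `sorry`.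
-/

noncomputable section

open Real Finset Filter Topology MeasureTheory ProbabilityTheory

namespace Summit.QuantumFields.YangMills.Theorems.BalabanUVNodesN19StringFieldLawClosedForm

open Literature.MathematicalPhysics.QuantumFieldTheory.Balaban1983to89
open T4GenFunBounds (prodObs gibbsMeasure schemeZ)
open Missing (TorusScheme)
open Summit.QuantumFields.BalabanUV.T4Continuum.Spine
open Summit.QuantumFields.YangMills.BalabanUVNodes.N19ExpectationCurrencyAtScheme (mul_nonneg_of_matchingModConstants)
open Summit.QuantumFields.YangMills.Theorems.BalabanUVNodesN19JointLawSharpRate (abs_integral_stringField_sub_le_of_uniformTarget_jackson)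
open Summit.QuantumFields.YangMills.Theorems.BalabanUVNodesN19JointLawPriceDimension (abs_integral_le_of_cube)
open Summit.QuantumFields.YangMills.Theorems.BalabanUVNodesN19UniformMomentPriceTwoSided (log_nine_le_five_halves)

/-! ## §1 The two parameters as functions of `L = log R⁻¹` [bookkeeping] -/

/-- The truncation level `M = ⌊log₂⌊1+L⌋⌋ + 1` has `2^{−M} ≤ 2∕(1+L)` and `1 ≤ M ≤ 1 + log(1+L)∕log 2` (`L ≥ 0`). [bookkeeping] -/
theorem truncLevel_bounds {L : ℝ} (hL : 0 ≤ L) :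
    (1 / 2 : ℝ) ^ (Nat.log 2 ⌊1 + L⌋₊ + 1) ≤ 2 / (1 + L) ∧
      ((Nat.log 2 ⌊1 + L⌋₊ + 1 : ℕ) : ℝ) ≤ 1 + Real.log (1 + L) / Real.log 2 := by
  set n : ℕ := ⌊1 + L⌋₊ with hn
  have hn1 : 1 ≤ n := Nat.le_floor (by simp [hL])
  have hn0 : n ≠ 0 := by omega
  have hnr : (n : ℝ) ≤ 1 + L := Nat.floor_le (by linarith)
  have hnr' : (1 + L) / 2 ≤ n := by
    have := Nat.lt_floor_add_one (1 + L)
    rw [← hn] at this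
    have h1 : (1 : ℝ) ≤ n := by exact_mod_cast hn1
    linarith
  constructor
  · -- `2^{M} > n ≥ (1+L)∕2`
    have h := Nat.lt_pow_succ_log_self one_lt_two n
    have h' : (n : ℝ) < (2 : ℝ) ^ (Nat.log 2 n + 1) := by exact_mod_cast h
    rw [one_div_pow, div_le_div_iff₀ (by positivity) (by positivity), one_mul]
    linarith
  · -- `2^{M−1} ≤ n ≤ 1 + L`
    have h := Nat.pow_log_le_self 2 hn0
    have h' : (2 : ℝ) ^ Nat.log 2 n ≤ 1 + L := by exact_mod_cast (show ((2 ^ Nat.log 2 n : ℕ) : ℝ) ≤ n by exact_mod_cast h).trans hnr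
    have hlog : (Nat.log 2 n : ℝ) * Real.log 2 ≤ Real.log (1 + L) := by
      rw [← Real.log_pow]
      exact Real.log_le_log (by positivity) h'
    have hl2 : 0 < Real.log 2 := Real.log_pos one_lt_two
    push_cast
    rw [add_comm, add_le_add_iff_left, le_div_iff₀ hl2]
    exact hlog

/-! ## §2 ★★ The closed form at the scheme -/

variable {G : Type*} [GaugeGroup G] [MeasurableSpace G] [RegularGaugeGroup G] [HaarData G] {O : Type*}
  (S : TorusScheme G O) (hβ : ∀ K, 0 ≤ S.β K) (hm : ∀ K o, Measurable (S.obs K o)) (h1 : ∀ K o U, |S.obs K o U| ≤ 1)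
include hβ hm h1

/-- ★★ **THE STRING-FIELD LAW IN CLOSED FORM: `(80K + 12G)·(1 + log(1+L)∕log 2)²∕(1+L)`, `L = log R_K⁻¹`.**  Under `Spine.NE7.Target vol l₀ δ (schemeZ S os)`
for EVERY string (`0 < l₀`; `[Countable O]`), for a string-field law `Λ` on `[−1,1]^{List O}` receiving all continuous functionals, an enumeration
`e : ℕ → List O`, a continuous `F` that is `K_F`-Lipschitz for `d_e(x,y) = Σ_j 2^{−(j+1)}|x_{e_j} − y_{e_j}|` and `G_F`-bounded on the cube, and every step
`K` with `R_K = (4e^{1+l₀}∕l₀)·τ_K·(1 + log⁺τ_K⁻¹) ∈ (0, 1]`: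
`|∫ F((∏os)_{os}) dgibbs_K − ∫ F dΛ| ≤ (80K_F + 12G_F)·(1 + log(1 + log R_K⁻¹)∕log 2)²∕(1 + log R_K⁻¹)` — module 62 §2's `(M,m)`-rate at
`M = ⌊log₂⌊1+L⌋⌋+1`, `m = ⌊L∕(5M)⌋`; order `(log L)²∕L` (`(log K)²∕K` for geometric remainders). [bookkeeping] -/
theorem abs_integral_stringField_sub_le_closedForm_of_uniformTarget [Countable O] {vol l₀ : ℝ} {δ : ℕ → ℝ} (hl₀ : 0 < l₀)
    (hT : ∀ os : List O, NE7.Target vol l₀ δ (schemeZ S os)) (Λ : Measure (List O → ℝ)) [IsProbabilityMeasure Λ]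
    (hΛ1 : Λ (Set.pi Set.univ (fun _ : List O => Set.Icc (-1 : ℝ) 1))ᶜ = 0)
    (hΛ : ∀ F : (List O → ℝ) → ℝ, Continuous F →
      Tendsto (fun K => ∫ U, F (fun os => prodObs S K os U) ∂gibbsMeasure (S.P K) (S.β K)) atTop (𝓝 (∫ x, F x ∂Λ)))
    (e : ℕ → List O) {F : (List O → ℝ) → ℝ} (hFc : Continuous F) {KF GF : ℝ} (hK0 : 0 ≤ KF)
    (hF : ∀ x y : List O → ℝ, (∀ os, x os ∈ Set.Icc (-1 : ℝ) 1) → (∀ os, y os ∈ Set.Icc (-1 : ℝ) 1) →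
      |F x - F y| ≤ KF * ∑' j, (1 / 2 : ℝ) ^ (j + 1) * |x (e j) - y (e j)|)
    (hG : ∀ x : List O → ℝ, (∀ os, x os ∈ Set.Icc (-1 : ℝ) 1) → |F x| ≤ GF) (K : ℕ)
    (hR0 : 0 < 4 * Real.exp (1 + l₀) / l₀ * (∑' j, 2 * (vol * δ (K + j))) * (1 + Real.posLog (∑' j, 2 * (vol * δ (K + j)))⁻¹))
    (hR1 : 4 * Real.exp (1 + l₀) / l₀ * (∑' j, 2 * (vol * δ (K + j))) * (1 + Real.posLog (∑' j, 2 * (vol * δ (K + j)))⁻¹) ≤ 1) :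
    |∫ U, F (fun os => prodObs S K os U) ∂gibbsMeasure (S.P K) (S.β K) - ∫ x, F x ∂Λ| ≤
      (80 * KF + 12 * GF) *
        (1 + Real.log (1 + Real.log (4 * Real.exp (1 + l₀) / l₀ * (∑' j, 2 * (vol * δ (K + j))) *
          (1 + Real.posLog (∑' j, 2 * (vol * δ (K + j)))⁻¹))⁻¹) / Real.log 2) ^ 2 /
        (1 + Real.log (4 * Real.exp (1 + l₀) / l₀ * (∑' j, 2 * (vol * δ (K + j))) *
          (1 + Real.posLog (∑' j, 2 * (vol * δ (K + j)))⁻¹))⁻¹) := by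
  haveI hP : IsProbabilityMeasure (gibbsMeasure (G := G) (S.P K) (S.β K)) := T4GenFunBounds.isProbabilityMeasure_gibbsMeasure (G := G) (S.P K) (hβ K)
  have hG0 : 0 ≤ GF := (abs_nonneg _).trans (hG (fun _ => 0) fun _ => ⟨by norm_num, by norm_num⟩)
  -- module 62 §2 at every `(M, m)`, then make the rate OPAQUE (`generalize`) so that no tactic unfolds `⌊·⌋₊ ∕ Nat.log` on reals
  have hJall := fun (M : ℕ) {m : ℕ} (hm0 : 0 < m) =>
    abs_integral_stringField_sub_le_of_uniformTarget_jackson S hβ hm h1 hl₀ hT Λ hΛ1 hΛ e hFc hK0 hF hG M hm0 K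
  -- the trivial bound `2G`
  have htriv : |∫ U, F (fun os => prodObs S K os U) ∂gibbsMeasure (S.P K) (S.β K) - ∫ x, F x ∂Λ| ≤ 2 * GF := by
    have hA : |∫ U, F (fun os => prodObs S K os U) ∂gibbsMeasure (S.P K) (S.β K)| ≤ GF := by
      have hb : ∀ᵐ U ∂gibbsMeasure (S.P K) (S.β K), ‖F (fun os => prodObs S K os U)‖ ≤ GF :=
        Filter.Eventually.of_forall fun U => by
          rw [Real.norm_eq_abs]
          exact hG _ fun os => abs_le.1 (T4GenFunBounds.abs_prodObs_le_one S h1 K os U)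
      have h := norm_integral_le_of_norm_le_const hb
      rwa [probReal_univ, mul_one, Real.norm_eq_abs] at h
    have hB : |∫ x, F x ∂Λ| ≤ GF := abs_integral_le_of_cube hΛ1 hG
    calc _ ≤ |∫ U, F (fun os => prodObs S K os U) ∂gibbsMeasure (S.P K) (S.β K)| + |∫ x, F x ∂Λ| := abs_sub _ _
      _ ≤ GF + GF := add_le_add hA hB
      _ = 2 * GF := by ring
  generalize hD : |∫ U, F (fun os => prodObs S K os U) ∂gibbsMeasure (S.P K) (S.β K) - ∫ x, F x ∂Λ| = D at hJall htriv ⊢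
  generalize hR : 4 * Real.exp (1 + l₀) / l₀ * (∑' j, 2 * (vol * δ (K + j))) * (1 + Real.posLog (∑' j, 2 * (vol * δ (K + j)))⁻¹) = R
    at hR0 hR1 hJall ⊢
  clear hD hR hF hG hΛ hΛ1 hFc hT hP
  -- `L = log R⁻¹ ≥ 0`, `R = e^{−L}`
  have hL0 : 0 ≤ Real.log R⁻¹ := Real.log_nonneg ((one_le_inv₀ hR0).2 hR1)
  have hRL : R = Real.exp (-Real.log R⁻¹) := by rw [Real.exp_neg, Real.exp_log (inv_pos.2 hR0), inv_inv]
  generalize hL : Real.log R⁻¹ = L at hL0 hRL ⊢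
  -- the truncation level `M`
  obtain ⟨hM2, hMlog⟩ := truncLevel_bounds hL0
  generalize hM : Nat.log 2 ⌊1 + L⌋₊ + 1 = M at hM2 hMlog
  have hM1 : (1 : ℝ) ≤ M := by rw [← hM]; exact_mod_cast Nat.le_add_left 1 _
  have hMpos : (0 : ℝ) < M := by linarith
  -- `Y = 1 + log(1+L)∕log 2 ≥ M ≥ 1`
  generalize hY : 1 + Real.log (1 + L) / Real.log 2 = Y at hMlog ⊢
  have hMY : (M : ℝ) ≤ Y := hMlog
  have hY1 : 1 ≤ Y := hM1.trans hMY
  have hMY2 : (M : ℝ) ^ 2 ≤ Y ^ 2 := pow_le_pow_left₀ hMpos.le hMY 2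
  have hY2 : (1 : ℝ) ≤ Y ^ 2 := one_le_pow₀ hY1
  -- target shape
  suffices h : D ≤ (80 * KF * Y ^ 2 + 12 * GF * Y ^ 2) / (1 + L) by
    calc D ≤ (80 * KF * Y ^ 2 + 12 * GF * Y ^ 2) / (1 + L) := h
      _ = (80 * KF + 12 * GF) * Y ^ 2 / (1 + L) := by ring
  rcases lt_or_ge L (5 * M) with hLM | hLM
  · -- `L < 5M`: `2G ≤ 12 G M∕(1+L) ≤ 12 G Y²∕(1+L)`
    have h6 : 1 + L ≤ 6 * M := by linarith
    have hMY' : (M : ℝ) ≤ Y ^ 2 := hMY.trans (by nlinarith)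
    have f1 := mul_le_mul_of_nonneg_left h6 (by positivity : (0 : ℝ) ≤ 2 * GF)
    have f2 := mul_le_mul_of_nonneg_left hMY' (by positivity : (0 : ℝ) ≤ 12 * GF)
    have f3 : 0 ≤ 80 * KF * Y ^ 2 := by positivity
    have hL1 : (0 : ℝ) < 1 + L := by linarith
    calc D ≤ 2 * GF := htriv
      _ ≤ 12 * GF * Y ^ 2 / (1 + L) := by
          rw [le_div_iff₀ hL1]
          linarith
      _ ≤ (80 * KF * Y ^ 2 + 12 * GF * Y ^ 2) / (1 + L) := div_le_div_of_nonneg_right (by linarith) hL1.le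
  · -- `5M ≤ L`: module 62 §2 at `M` and `m = ⌊L∕(5M)⌋ ≥ 1`
    have hy1 : (1 : ℝ) ≤ L / (5 * M) := by rw [le_div_iff₀ (by positivity)]; linarith
    have hmfloor1 : 1 ≤ ⌊L / (5 * M)⌋₊ := Nat.le_floor (by exact_mod_cast hy1)
    have hmfloor : (⌊L / (5 * M)⌋₊ : ℝ) ≤ L / (5 * M) := Nat.floor_le (by positivity)
    have hmfloor2 : L / (5 * M) < ⌊L / (5 * M)⌋₊ + 1 := Nat.lt_floor_add_one _
    generalize hmdef : ⌊L / (5 * M)⌋₊ = m at hmfloor1 hmfloor hmfloor2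
    have hm0 : 0 < m := hmfloor1
    have hm1r : (1 : ℝ) ≤ m := by exact_mod_cast hmfloor1
    have hmy : (m : ℝ) ≤ L / (5 * M) := hmfloor
    have hmy2 : L / (5 * M) ≤ 2 * m := by linarith
    have hJ := hJall M hm0
    -- first term: `2K(1/2)^M ≤ 4K∕(1+L)`
    have hA : 2 * KF * (1 / 2 : ℝ) ^ M ≤ 4 * KF / (1 + L) := by
      calc 2 * KF * (1 / 2 : ℝ) ^ M ≤ 2 * KF * (2 / (1 + L)) := mul_le_mul_of_nonneg_left hM2 (by positivity)
        _ = 4 * KF / (1 + L) := by ring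
    -- middle term: `2πK M∕m ≤ 76 K M²∕(1+L)` (`1 + L ≤ 12 M m`, `24π ≤ 76`)
    have hLm : L ≤ 10 * M * m := by
      have h := (div_le_iff₀ (by positivity : (0 : ℝ) < 5 * M)).1 hmy2
      linarith
    have h1L : 1 + L ≤ 12 * M * m := by linarith
    have hB : 2 * KF * (π * M / m) ≤ 76 * KF * (M : ℝ) ^ 2 / (1 + L) := by
      have hmpos : (0 : ℝ) < m := by positivity
      rw [mul_div_assoc', div_le_div_iff₀ hmpos (by positivity)]
      have hπ : π < 3.15 := Real.pi_lt_d2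
      calc 2 * KF * (π * M) * (1 + L) ≤ 2 * KF * (π * M) * (12 * M * m) := mul_le_mul_of_nonneg_left h1L (by positivity)
        _ = (24 * π) * (KF * M ^ 2 * m) := by ring
        _ ≤ 76 * (KF * M ^ 2 * m) := mul_le_mul_of_nonneg_right (by linarith) (by positivity)
        _ = 76 * KF * (M : ℝ) ^ 2 * m := by ring
    -- last term: `(m·9^m)^M·R ≤ e^{L∕5}·e^{L∕2}·e^{−L} ≤ (10∕3)∕(1+L)`
    have h9 : ((9 : ℝ) ^ m) ^ M ≤ Real.exp (L / 2) := by
      rw [← pow_mul, ← Real.exp_log (by norm_num : (0 : ℝ) < 9), ← Real.exp_nat_mul]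
      refine Real.exp_le_exp.2 ?_
      push_cast
      calc (m : ℝ) * M * Real.log 9 ≤ L / (5 * M) * M * (5 / 2) :=
            mul_le_mul (mul_le_mul_of_nonneg_right hmy (by positivity)) log_nine_le_five_halves
              (Real.log_nonneg (by norm_num)) (by positivity)
        _ = L / 2 := by field_simp
    have hmd : (m : ℝ) ^ M ≤ Real.exp (L / 5) := by
      have hy : (0 : ℝ) ≤ L / (5 * M) := by positivity
      have h1 : L / (5 * M) ≤ Real.exp (L / (5 * M)) := by have := Real.add_one_le_exp (L / (5 * M)); linarith
      calc (m : ℝ) ^ M ≤ (L / (5 * M)) ^ M := pow_le_pow_left₀ (by positivity) hmy M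
        _ ≤ (Real.exp (L / (5 * M))) ^ M := pow_le_pow_left₀ hy h1 M
        _ = Real.exp (M * (L / (5 * M))) := by rw [← Real.exp_nat_mul]
        _ = Real.exp (L / 5) := by congr 1; field_simp
    have hprod : ((m : ℝ) * 9 ^ m) ^ M * R ≤ Real.exp (-(3 * L / 10)) := by
      rw [mul_pow, hRL]
      calc (m : ℝ) ^ M * ((9 : ℝ) ^ m) ^ M * Real.exp (-L) ≤ Real.exp (L / 5) * Real.exp (L / 2) * Real.exp (-L) :=
            mul_le_mul_of_nonneg_right (mul_le_mul hmd h9 (by positivity) (by positivity)) (by positivity)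
        _ = Real.exp (-(3 * L / 10)) := by rw [← Real.exp_add, ← Real.exp_add]; congr 1; ring
    have hexp : Real.exp (-(3 * L / 10)) ≤ (10 / 3) / (1 + L) := by
      have hE := Real.add_one_le_exp (3 * L / 10)
      have hE0 : 0 < Real.exp (3 * L / 10) := Real.exp_pos _
      rw [Real.exp_neg, inv_eq_one_div, div_le_div_iff₀ hE0 (by positivity)]
      have := mul_le_mul_of_nonneg_left hE (by norm_num : (0 : ℝ) ≤ 10 / 3)
      linarith
    have hC : GF * ((m : ℝ) * 9 ^ m) ^ M * R ≤ 4 * GF / (1 + L) := by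
      calc GF * ((m : ℝ) * 9 ^ m) ^ M * R = GF * (((m : ℝ) * 9 ^ m) ^ M * R) := by ring
        _ ≤ GF * ((10 / 3) / (1 + L)) := mul_le_mul_of_nonneg_left (hprod.trans hexp) hG0
        _ ≤ 4 * GF / (1 + L) := by
            rw [mul_div_assoc', div_le_div_iff_of_pos_right (by positivity)]
            linarith
    have hsum : 2 * KF * (1 / 2 : ℝ) ^ M + 2 * KF * (π * M / m) + GF * ((m : ℝ) * 9 ^ m) ^ M * R ≤
        (4 * KF + 76 * KF * (M : ℝ) ^ 2 + 4 * GF) / (1 + L) := by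
      have h := add_le_add (add_le_add hA hB) hC
      have e : 4 * KF / (1 + L) + 76 * KF * (M : ℝ) ^ 2 / (1 + L) + 4 * GF / (1 + L) =
          (4 * KF + 76 * KF * (M : ℝ) ^ 2 + 4 * GF) / (1 + L) := by ring
      exact h.trans_eq e
    have hnum : 4 * KF + 76 * KF * (M : ℝ) ^ 2 + 4 * GF ≤ 80 * KF * Y ^ 2 + 12 * GF * Y ^ 2 := by
      have f1 := mul_le_mul_of_nonneg_left hMY2 (by positivity : (0 : ℝ) ≤ 76 * KF)
      have f2 := mul_le_mul_of_nonneg_left hY2 (by positivity : (0 : ℝ) ≤ 4 * KF)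
      have f3 := mul_le_mul_of_nonneg_left hY2 (by positivity : (0 : ℝ) ≤ 4 * GF)
      have f4 : 0 ≤ GF * Y ^ 2 := by positivity
      linarith
    exact hJ.trans (hsum.trans (div_le_div_of_nonneg_right hnum (by positivity)))

end Summit.QuantumFields.YangMills.Theorems.BalabanUVNodesN19StringFieldLawClosedForm

end
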